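import Literature.MathematicalPhysics.QuantumFieldTheory.Balaban1983to89.B4Ineq19WalkRoute
import Literature.MathematicalPhysics.QuantumFieldTheory.Balaban1983to89.B4Eq16GreenExists

/-!
# `Balaban1983to89.B4WalkRouteRegion` — [Balaban1983RegularityDecay] §2: THE WALK ROUTE OF THE THEOREM p. 573 ON [B4]'s
# CONCRETE REGION CARRIERS — every STRUCTURAL hypothesis of `B4Ineq110WalkRoute` / `B4Ineq110WalkRouteDeriv` /
# `B4Ineq112WalkRoute` / `B4Ineq19WalkRoute` (locality of bonds and blocks, the label set, the block-compatible cubes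
# `□_j`, the plateau agreement of the modified configurations `Ã_j`, the existence of the cube propagators
# `G_k(□_j,Ã_j)` and of `G_k(Ω,A)` FOR EVERY CONFIGURATION) DISCHARGED for the operator
# `−Δ^{η,N}_{A,Ω} + m² + a_kP_k(A)` of (1.6) on the fine region over a finite union of unit blocks
# (`B4Lower18RegularRegion.regionOp` / `B4GaugeCovariance.b4Op`), leaving exactly the per-cube analytic inputs

statement-level skeleton of published theorems with citation tags; proofs where landed; nothing here is a claim about the Yang–Mills mass gap

CITATION HEADER.  T. Bałaban, *Regularity and decay of lattice Green's functions*, Commun. Math. Phys. **89** (1983)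
571–597, doi:10.1007/bf01214744 [Balaban1983RegularityDecay] (cell paper B4; held text
`paper:balaban1983-cmp89-regularity-decay`, journal page = PDF page + 570; pp. 572–573, 575–579).  Unit `lit-balaban-r01`
gen 6 (B4 fold owner), HOME `run/shared/lean/pub/lit-balaban/`, SKELETON rows **B4.Thm@573**, **B4.Def§2** (the cubes
`□_j` and the configurations `Ã_j`), **B4.Eq2.2**, **B4.Eq2.12**, **B4.Eq1.6**.  Imports `B4Ineq19WalkRoute` (the walk
route for arbitrary probes and its instances) and `B4Eq16GreenExists` (positivity of (1.6) for every configuration on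
the region carriers of `B4Lower18RegularRegion`).

WHAT IS PRINTED (p. 575, verbatim).  *«Let us define the following sequence of cubes □_j = Ω ∩ {…}, j ∈ Z^d … If
□_j is an interior cube of Ω, then … we define Ã_j = A₀ + θ_jA′ … If □_j intersects the boundary ∂Ω, then we take
Ã_j = A. … G₀ = Σ_j h_jG_k(□_j,Ã_j)h_j (2.2)»*; p. 577: *«(2.13) … It is a basic representation and all the statements
of Proposition I.2.1 follow from it and from some properties of the propagators G_k(□_j,Ã_j).»*

WHAT THIS MODULE PROVES (all in full).  Carrier: the fine region `X = fineDom n Ωc` (`B4Lower18.fineDom`: the sites of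
`ℤ^{d+1}` whose unit-block label `blk n x` lies in the finite label set `Ωc`; mesh `η = 1/n`), [B4]'s Neumann bond
weights `regWt`, block weights `rBlkWt`, base points `rbaseEmb` and staircase contours `rstairContour`
(`B4Lower18RegularRegion`), the flow `F` (`U(A_b) = F.U(κA_b)`), ANY bond configuration `A : X → X → ℝ`; the walk
scale `M = nK` (`K ≥ 16` unit blocks).
* §1 `rpos` (integer coordinates as positions), `labels` (the finite label set), `cubeSet` (the block-compatible cube
  `S_j`: unit blocks whose base corner is within `(7/8)M + n` of `Mj`), `cubeGreen` (the inverse of the Neumann-cut cube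
  operator built with the modified configuration `Ã_j`).
* §2 the structural hypotheses: `regWt_local` (`hc`), `rBlkWt_local` (`hq`), `labels_complete` (`hs`),
  `cubeSet_of_near` (`hS`), `near_of_cubeSet` (`hS1`), `cubeSet_iff_of_blk` (`hSq`), `fieldLink_window` (`hWW'`),
  `contourTrans_window` (`hTT'`), and **`covOp_blockLocal_posDef`**: for ANY non-negative weights agreeing with
  `regWt` inside the unit blocks (every Neumann cut along block-compatible sets, in particular the cut cube operators
  and the `Ω ⊂ Ω₀` cut) and ANY configuration, the operator (1.6) is positive definite — hence `cubeOp_mul_cubeGreen`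
  (`hGj`) and `green_mul_op` (`hGH`).
* §3 THE MEMBERS OF THE THEOREM p. 573 FOR `G_k(Ω,A) = (−Δ^{η,N}_{A,Ω} + m² + a′P_k(A))⁻¹` ON THE REGION CARRIER, with
  ONLY the per-cube analytic inputs (and the plateau agreement of the chosen `Ã_j` with `A`) as hypotheses:
  **`ineq110_value_region`**, **`ineq110_deriv_region`**, **`ineq19_holder_region`** (value, derivative, Hölder members
  of (1.9)–(1.10)), and **`ineq112_value_region`** ((1.11)–(1.12) value member for the Neumann cut `Ω ⊂ Ω₀` along a
  sub-family of unit blocks).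

* v1.1: `cubeOpSub_mul_cubeGreenSub`, `greenSub_mul_op`, **`ineq112_deriv_region`**, **`ineq112_holder_region`** — the
  derivative and Hölder members of the δG clause (1.11)–(1.12) on the region carrier (so all six members of the Theorem
  p. 573 are available on `fineDom n Ωc` modulo the per-cube inputs).

HONEST SCOPE.  (i) What remains assumed is exactly the print's «some properties of the propagators G_k(□_j,Ã_j)»:
the per-cube inputs `γ ≥ ‖G_j‖`, `γ′ ≥ ‖P_bG_j‖`, `γ_H ≥ ‖P_H·h_jG_jh_j‖`, `β ≥ ‖K_jG_jh_j‖` with (2.21)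
`3^{d+1}β ≤ e⁻¹`, in Mathlib's `ℓ^∞(X×ι) → ℓ^∞(X×ι)` operator norm on the whole region carrier (the cube operators are
the Neumann cuts at `∂S_j`, block-diagonal `S_j ⊕ (X ∖ S_j)`); producing them from Lemmas 2.1/2.2 (the box-carrier
theorems of the `B4Lemma22*` / `B4Eq220FactorField` lineage, after a translation/reindexing of `S_j` and a comparison
of the lineage's `supN` norm with the `ℓ^∞` norm over sites and colours) is reserve item R9.  (ii) The modified
configurations `Ã_j` are PARAMETERS subject only to the agreement `Ã_j = A` on the bonds within `(3/4)M + n` of `Mj`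
(print: `Ã_j = A₀ + θ_jA′`, `θ_j = 1` there; the regularity of `Ã_j` matters only for the inputs).  (iii) The region is
any finite union of unit blocks (print: «Ω is a sum of big blocks»); the cubes `S_j` here are unions of UNIT blocks
between the `(7/8)M`- and the `M`-box (block-compatibility is what the cancellation (2.6) needs); `K ≥ 16`.  (iv) No
`R₀`: as in the whole walk-route series the inputs are assumed for every cube.  No `sorry`; no new `Prop` fact; the
definitions carry bodies; axioms standard.
-/

namespace Literature.MathematicalPhysics.QuantumFieldTheory.Balaban1983to89.B4WalkRouteRegion

open Literature.MathematicalPhysics.QuantumFieldTheory.Balaban1983to89.B4GaugeCovariance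
open Literature.MathematicalPhysics.QuantumFieldTheory.Balaban1983to89.B4Commutators25to211
open Literature.MathematicalPhysics.QuantumFieldTheory.Balaban1983to89.B4PartitionUnity22
open Literature.MathematicalPhysics.QuantumFieldTheory.Balaban1983to89.B4Reflection242 (blk nbrs mem_nbrs blk_mul)
open Literature.MathematicalPhysics.QuantumFieldTheory.Balaban1983to89.B4Lower18 (fineDom mem_fineDom)
open Literature.MathematicalPhysics.QuantumFieldTheory.Balaban1983to89.B4Lower18Regular (PathRel base_le_of_blk
  fieldLink_orth)
open Literature.MathematicalPhysics.QuantumFieldTheory.Balaban1983to89.B4Lower18RegularRegion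
open Literature.MathematicalPhysics.QuantumFieldTheory.Balaban1983to89.B4Eq16GreenExists
open Literature.MathematicalPhysics.QuantumFieldTheory.Balaban1983to89.B4Ineq110WalkRoute
open Literature.MathematicalPhysics.QuantumFieldTheory.Balaban1983to89.B4Ineq110WalkRouteDeriv
open Literature.MathematicalPhysics.QuantumFieldTheory.Balaban1983to89.B4Ineq112WalkRoute
open Literature.MathematicalPhysics.QuantumFieldTheory.Balaban1983to89.B4Ineq112WalkRouteDeriv
open Literature.MathematicalPhysics.QuantumFieldTheory.Balaban1983to89.B4Ineq19WalkRoute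
open scoped Matrix NNReal

open scoped Matrix.Norms.Operator

variable {d : ℕ} {ι : Type*} [Fintype ι] [DecidableEq ι]

/-! ## §1. The objects of §2 of [B4] on the region carrier -/

section Objects

/-- positions of the fine sites: the integer coordinates (lattice units; the print's `x ∈ ηZ^d` with `η = 1/n`).
[cite: Balaban1983RegularityDecay, p.572 (1.1)] -/
abbrev rpos (n : ℕ) (Ωc : Finset (Fin (d + 1) → ℤ)) (x : ↥(fineDom n Ωc)) : Fin (d + 1) → ℝ :=
  fun μ => (x.1 μ : ℝ)

/-- the finite set of labels `j ∈ Z^d` whose cube `□_j` can meet the region («□_j = Ω ∩ {…}, j ∈ Z^d», only finitely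
many are non-empty). [cite: Balaban1983RegularityDecay, §2 p.575] -/
noncomputable def labels (M : ℝ) (n : ℕ) (Ωc : Finset (Fin (d + 1) → ℤ)) : Finset (Fin (d + 1) → ℤ) :=
  Finset.univ.biUnion fun x : ↥(fineDom n Ωc) =>
    Fintype.piFinset fun μ => ({⌊(x.1 μ : ℝ) / M⌋, ⌊(x.1 μ : ℝ) / M⌋ + 1} : Finset ℤ)

/-- THE CUBE `□_j` AS A BLOCK-COMPATIBLE SITE SET `S_j`: the unit blocks whose base corner lies within `(7/8)M + n` of
`Mj` (so `(7/8)M`-box `⊆ S_j ⊆ M`-box for `M = nK`, `K ≥ 16`, and no unit block crosses `∂S_j`).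
[cite: Balaban1983RegularityDecay, §2 p.575 «□_j = Ω ∩ {z : |z_μ − jM| ≤ …}»] -/
def cubeSet (n : ℕ) (M : ℝ) (Ωc : Finset (Fin (d + 1) → ℤ)) (j : Fin (d + 1) → ℤ) (x : ↥(fineDom n Ωc)) : Prop :=
  ∀ μ, |(n : ℝ) * (blk n x.1 μ : ℝ) - M * j μ| ≤ 7 / 8 * M + n

/-- membership in `S_j` is decidable (real inequalities, classically). [folklore] -/
noncomputable instance cubeSet.instDecidablePred (n : ℕ) (M : ℝ) (Ωc : Finset (Fin (d + 1) → ℤ))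
    (j : Fin (d + 1) → ℤ) : DecidablePred (cubeSet n M Ωc j) := fun x => by
  unfold cubeSet; infer_instance

/-- THE CUBE PROPAGATOR `G_k(□_j, Ã_j)` ON THE REGION CARRIER: the inverse of the Neumann cut at `∂S_j` of the operator
(1.6) built with the modified configuration `Ã_j` (block-diagonal `S_j ⊕ (X ∖ S_j)`; the walk expansion sees only the
`S_j`-block through `h_j`). [cite: Balaban1983RegularityDecay, (2.2) p.575 «G₀ = Σ_j h_jG_k(□_j,Ã_j)h_j»] -/
noncomputable def cubeGreen (F : OrthFlow ι) (κ : ℝ) {n : ℕ} (hn : 1 ≤ n) (M m2 a : ℝ)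
    (Ωc : Finset (Fin (d + 1) → ℤ))
    (At : (Fin (d + 1) → ℤ) → ↥(fineDom n Ωc) → ↥(fineDom n Ωc) → ℝ) (j : Fin (d + 1) → ℤ) :
    Matrix (↥(fineDom n Ωc) × ι) (↥(fineDom n Ωc) × ι) ℝ :=
  (covOp (fun z z' => if (cubeSet n M Ωc j z ↔ cubeSet n M Ωc j z') then regWt n (fineDom n Ωc) z z' else 0) m2 a
    (rBlkWt n Ωc (fineDom n Ωc)) (fieldLink F κ (At j))
    (contourTrans (fieldLink F κ (At j)) (rbaseEmb hn Ωc) (rstairContour hn Ωc)))⁻¹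

end Objects

/-! ## §2. The structural hypotheses of the walk route, discharged on the region carrier -/

section Structure

variable {n : ℕ}

/-- lattice geometry: a site and its unit-block base corner differ by at most `n` in every coordinate
(`0 ≤ x_μ − n·blk(x)_μ ≤ n`). [folklore] -/
private theorem abs_sub_blk_le (hn : 1 ≤ n) (x : Fin (d + 1) → ℤ) (μ : Fin (d + 1)) :
    |(x μ : ℝ) - (n : ℝ) * (blk n x μ : ℝ)| ≤ n := by
  obtain ⟨h1, h2⟩ := base_le_of_blk hn (rfl : blk n x = blk n x)
  have h1μ : (n : ℤ) * blk n x μ ≤ x μ := h1 μ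
  have h2μ : x μ - n * blk n x μ ≤ n := h2 μ
  have e1 : ((n : ℤ) : ℝ) * (blk n x μ : ℝ) ≤ (x μ : ℝ) := by exact_mod_cast h1μ
  have e2 : (x μ : ℝ) - ((n : ℤ) : ℝ) * (blk n x μ : ℝ) ≤ ((n : ℤ) : ℝ) := by exact_mod_cast h2μ
  rw [Int.cast_natCast] at e1 e2
  rw [abs_le]; constructor <;> linarith

/-- two sites of the same unit block differ by at most `n` in every coordinate. [folklore] -/
private theorem abs_sub_le_of_blk_eq (hn : 1 ≤ n) {x z : Fin (d + 1) → ℤ} (h : blk n x = blk n z)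
    (μ : Fin (d + 1)) : |(x μ : ℝ) - (z μ : ℝ)| ≤ n := by
  obtain ⟨hx1, hx2⟩ := base_le_of_blk hn (rfl : blk n x = blk n x)
  obtain ⟨hz1, hz2⟩ := base_le_of_blk hn h.symm
  have a1 : (n : ℤ) * blk n x μ ≤ x μ := hx1 μ
  have a2 : x μ - n * blk n x μ ≤ n := hx2 μ
  have b1 : (n : ℤ) * blk n x μ ≤ z μ := hz1 μ
  have b2 : z μ - n * blk n x μ ≤ n := hz2 μ
  have e : |x μ - z μ| ≤ (n : ℤ) := by rw [abs_le]; constructor <;> linarith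
  have e' : ((|x μ - z μ| : ℤ) : ℝ) ≤ ((n : ℤ) : ℝ) := by exact_mod_cast e
  rw [Int.cast_abs, Int.cast_sub, Int.cast_natCast] at e'
  exact e'

/-- nearest neighbours differ by at most `1` in every coordinate. [folklore] -/
private theorem abs_sub_le_one_of_mem_nbrs {x z : Fin (d + 1) → ℤ} (h : z ∈ nbrs x) (μ : Fin (d + 1)) :
    |(x μ : ℝ) - (z μ : ℝ)| ≤ 1 := by
  obtain ⟨i, hi⟩ := mem_nbrs.mp h
  have key : |x μ - z μ| ≤ (1 : ℤ) := by
    rcases hi with rfl | rfl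
    · simp only [Pi.add_apply, Pi.single_apply]
      split_ifs <;> simp
    · simp only [Pi.sub_apply, Pi.single_apply]
      split_ifs <;> simp
  have e : ((|x μ - z μ| : ℤ) : ℝ) ≤ ((1 : ℤ) : ℝ) := by exact_mod_cast key
  rw [Int.cast_abs, Int.cast_sub, Int.cast_one] at e
  exact e

variable (hn : 1 ≤ n) (Ωc : Finset (Fin (d + 1) → ℤ)) {K : ℕ} (hK : 16 ≤ K)
include hn hK

/-- the walk scale `M = nK` is positive. [folklore] -/
private theorem M_pos : (0 : ℝ) < n * K := by
  have : (1 : ℝ) ≤ n := by exact_mod_cast hn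
  have : (16 : ℝ) ≤ K := by exact_mod_cast hK
  positivity

omit hK in
/-- `hc`: [B4]'s Neumann bonds have length `1 ≤ M/8`. [cite: Balaban1983RegularityDecay, (1.3) p.572] -/
theorem regWt_local (hK8 : 8 ≤ K) (x z' : ↥(fineDom n Ωc)) (h : regWt n (fineDom n Ωc) x z' ≠ 0) (μ : Fin (d + 1)) :
    |rpos n Ωc x μ - rpos n Ωc z' μ| ≤ 1 / 8 * (n * K) := by
  have hnb : z'.1 ∈ nbrs x.1 := by
    by_contra hne
    apply h
    simp [regWt, hne]
  have h1 : (1 : ℝ) ≤ n := by exact_mod_cast hn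
  have h8 : (8 : ℝ) ≤ K := by exact_mod_cast hK8
  calc |rpos n Ωc x μ - rpos n Ωc z' μ| ≤ 1 := abs_sub_le_one_of_mem_nbrs hnb μ
    _ ≤ 1 / 8 * (n * K) := by nlinarith

omit hK in
/-- `hq`: the sites of one averaging block are within `n ≤ M/8` of each other. [cite: Balaban1983RegularityDecay, (1.4) p.572] -/
theorem rBlkWt_local (hK8 : 8 ≤ K) (y : ↥Ωc) (x z' : ↥(fineDom n Ωc)) (hx : rBlkWt n Ωc (fineDom n Ωc) y x ≠ 0)
    (hz : rBlkWt n Ωc (fineDom n Ωc) y z' ≠ 0) (μ : Fin (d + 1)) :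
    |rpos n Ωc x μ - rpos n Ωc z' μ| ≤ 1 / 8 * (n * K) := by
  have hb : blk n x.1 = blk n z'.1 := by rw [rBlkWt_ne_zero hx, rBlkWt_ne_zero hz]
  have h8 : (8 : ℝ) ≤ K := by exact_mod_cast hK8
  have hn0 : (0 : ℝ) ≤ n := by positivity
  calc |rpos n Ωc x μ - rpos n Ωc z' μ| ≤ n := abs_sub_le_of_blk_eq hn hb μ
    _ ≤ 1 / 8 * (n * K) := by nlinarith

omit hn hK in
/-- `hs`: every label whose `h_j` sees a site of the region belongs to `labels`. [cite: Balaban1983RegularityDecay, §2 p.575] -/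
theorem labels_complete (M : ℝ) (j : Fin (d + 1) → ℤ) (x : ↥(fineDom n Ωc)) (h : hCube M j (rpos n Ωc x) ≠ 0) :
    j ∈ labels M n Ωc := by
  classical
  rw [labels, Finset.mem_biUnion]
  exact ⟨x, Finset.mem_univ _, mem_box_of_hCube_ne_zero h⟩

omit hK in
/-- `hS`: the `(7/8)M`-box around `Mj` lies in `S_j`. [cite: Balaban1983RegularityDecay, §2 p.575] -/
theorem cubeSet_of_near (j : Fin (d + 1) → ℤ) (z : ↥(fineDom n Ωc))
    (h : ∀ μ, |rpos n Ωc z μ - (n * K) * j μ| ≤ 7 / 8 * (n * K)) : cubeSet n (n * K) Ωc j z := by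
  intro μ
  have h1 := abs_sub_blk_le hn z.1 μ
  have h2 := h μ
  calc |(n : ℝ) * (blk n z.1 μ : ℝ) - (n * K) * j μ|
      = |((n : ℝ) * (blk n z.1 μ : ℝ) - (z.1 μ : ℝ)) + ((z.1 μ : ℝ) - (n * K) * j μ)| := by ring_nf
    _ ≤ |(n : ℝ) * (blk n z.1 μ : ℝ) - (z.1 μ : ℝ)| + |(z.1 μ : ℝ) - (n * K) * j μ| := abs_add_le _ _
    _ ≤ n + 7 / 8 * (n * K) := add_le_add (by rw [abs_sub_comm]; exact h1) h2
    _ = 7 / 8 * (n * K) + n := by ring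

/-- `hS1`: `S_j` lies in the `M`-box around `Mj` (`K ≥ 16`). [cite: Balaban1983RegularityDecay, §2 p.575] -/
theorem near_of_cubeSet (j : Fin (d + 1) → ℤ) (z : ↥(fineDom n Ωc)) (h : cubeSet n (n * K) Ωc j z)
    (μ : Fin (d + 1)) : |rpos n Ωc z μ - (n * K) * j μ| ≤ n * K := by
  have h1 := abs_sub_blk_le hn z.1 μ
  have h2 := h μ
  have h16 : (16 : ℝ) ≤ K := by exact_mod_cast hK
  have hn0 : (0 : ℝ) ≤ n := by positivity
  calc |rpos n Ωc z μ - (n * K) * j μ|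
      = |((z.1 μ : ℝ) - (n : ℝ) * (blk n z.1 μ : ℝ)) + ((n : ℝ) * (blk n z.1 μ : ℝ) - (n * K) * j μ)| := by
          simp only [rpos]; ring_nf
    _ ≤ |(z.1 μ : ℝ) - (n : ℝ) * (blk n z.1 μ : ℝ)| + |(n : ℝ) * (blk n z.1 μ : ℝ) - (n * K) * j μ| :=
        abs_add_le _ _
    _ ≤ n + (7 / 8 * (n * K) + n) := add_le_add h1 h2
    _ ≤ n * K := by nlinarith

omit hn hK in
/-- `hSq`: `S_j` is a union of unit blocks — two sites of one averaging block are both in or both out.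
[cite: Balaban1983RegularityDecay, (2.6) p.576] -/
theorem cubeSet_iff_of_blk (M : ℝ) (j : Fin (d + 1) → ℤ) (y : ↥Ωc) (z z' : ↥(fineDom n Ωc))
    (hz : rBlkWt n Ωc (fineDom n Ωc) y z ≠ 0) (hz' : rBlkWt n Ωc (fineDom n Ωc) y z' ≠ 0) :
    cubeSet n M Ωc j z ↔ cubeSet n M Ωc j z' := by
  unfold cubeSet
  rw [rBlkWt_ne_zero hz, rBlkWt_ne_zero hz']

omit hn hK in
/-- `hWW'`: the link variables of `Ã_j` and of `A` agree on the bonds of the `(3/4)M`-window where `Ã_j = A`.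
[cite: Balaban1983RegularityDecay, §2 p.575 «Ã_j = A₀ + θ_jA′», θ_j = 1 on the window] -/
theorem fieldLink_window (F : OrthFlow ι) (κ M : ℝ) (A : ↥(fineDom n Ωc) → ↥(fineDom n Ωc) → ℝ)
    (At : (Fin (d + 1) → ℤ) → ↥(fineDom n Ωc) → ↥(fineDom n Ωc) → ℝ)
    (hAt : ∀ j u v, (∀ μ, |rpos n Ωc u μ - M * j μ| ≤ 3 / 4 * M + n) →
      (∀ μ, |rpos n Ωc v μ - M * j μ| ≤ 3 / 4 * M + n) → At j u v = A u v)
    (j : Fin (d + 1) → ℤ) (x z' : ↥(fineDom n Ωc)) (hx : ∀ μ, |rpos n Ωc x μ - M * j μ| ≤ 3 / 4 * M)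
    (hz : ∀ μ, |rpos n Ωc z' μ - M * j μ| ≤ 3 / 4 * M) :
    fieldLink F κ (At j) x z' = fieldLink F κ A x z' := by
  have hn0 : (0 : ℝ) ≤ n := by positivity
  unfold fieldLink
  rw [hAt j x z' (fun μ => (hx μ).trans (by linarith)) (fun μ => (hz μ).trans (by linarith))]

omit hn hK in
/-- a path relation propagating a property of the start point along the steps. [folklore] -/
private theorem pathRel_imp_of_start {X : Type*} {r r' : X → X → Prop} {P : X → Prop}
    (hP : ∀ u v, P u → r u v → P v ∧ r' u v) :
    ∀ (a : X) (l : List X), P a → PathRel r a l → PathRel r' a l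
  | _, [], _, _ => trivial
  | a, b :: l, ha, h => ⟨(hP a b ha h.1).2, pathRel_imp_of_start hP b l (hP a b ha h.1).1 h.2⟩

omit hn hK in
/-- transports along a path agree when the link variables agree on its steps. [folklore] -/
private theorem transport_congr {X : Type*} {W₁ W₂ : X → X → Matrix ι ι ℝ} {r : X → X → Prop}
    (h : ∀ u v, r u v → W₁ u v = W₂ u v) :
    ∀ (a : X) (l : List X), PathRel r a l → transport W₁ a l = transport W₂ a l
  | _, [], _ => rfl
  | a, b :: l, hl => by
      rw [transport, transport, h a b hl.1, transport_congr h b l hl.2]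

omit hK in
/-- the staircase contour `Γ_{y,x}` runs inside the unit block `B(y)`: every step joins two sites of `B(y)` by a
nearest-neighbour bond. [cite: Balaban1983RegularityDecay, p.572 «Γ^{(k)}_{y,x}»] -/
theorem rstairContour_inside (y : ↥Ωc) (x : ↥(fineDom n Ωc)) :
    PathRel (fun u v : ↥(fineDom n Ωc) => blk n u.1 = y.1 ∧ blk n v.1 = y.1 ∧ v.1 ∈ nbrs u.1) (rbaseEmb hn Ωc y)
      (rstairContour hn Ωc y x) :=
  pathRel_imp_of_start (r := fun u v : ↥(fineDom n Ωc) => v.1 ∈ nbrs u.1 ∧ blk n v.1 = y.1)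
    (P := fun u : ↥(fineDom n Ωc) => blk n u.1 = y.1) (fun _ _ hu huv => ⟨huv.2, hu, huv.2, huv.1⟩)
    _ _ (rbaseEmb_blk hn Ωc y) (rstairContour_path hn Ωc y x)

omit hK in
/-- `hTT'`: the transporters `U(Ã_j(Γ_{y,x}))` and `U(A(Γ_{y,x}))` agree for `x ∈ B(y)` in the `(3/4)M`-window (the
contour stays in `B(y)`, within `n` of `x`). [cite: Balaban1983RegularityDecay, (1.4) p.572, §2 p.575] -/
theorem contourTrans_window (F : OrthFlow ι) (κ M : ℝ) (A : ↥(fineDom n Ωc) → ↥(fineDom n Ωc) → ℝ)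
    (At : (Fin (d + 1) → ℤ) → ↥(fineDom n Ωc) → ↥(fineDom n Ωc) → ℝ)
    (hAt : ∀ j u v, (∀ μ, |rpos n Ωc u μ - M * j μ| ≤ 3 / 4 * M + n) →
      (∀ μ, |rpos n Ωc v μ - M * j μ| ≤ 3 / 4 * M + n) → At j u v = A u v)
    (j : Fin (d + 1) → ℤ) (y : ↥Ωc) (x : ↥(fineDom n Ωc)) (hyx : rBlkWt n Ωc (fineDom n Ωc) y x ≠ 0)
    (hx : ∀ μ, |rpos n Ωc x μ - M * j μ| ≤ 3 / 4 * M) :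
    contourTrans (fieldLink F κ (At j)) (rbaseEmb hn Ωc) (rstairContour hn Ωc) y x
      = contourTrans (fieldLink F κ A) (rbaseEmb hn Ωc) (rstairContour hn Ωc) y x := by
  have hb : blk n x.1 = y.1 := rBlkWt_ne_zero hyx
  -- every site of `B(y)` is within `(3/4)M + n` of `Mj`
  have hwin : ∀ u : ↥(fineDom n Ωc), blk n u.1 = y.1 → ∀ μ, |rpos n Ωc u μ - M * j μ| ≤ 3 / 4 * M + n := by
    intro u hu μ
    have h1 : |(u.1 μ : ℝ) - (x.1 μ : ℝ)| ≤ n := abs_sub_le_of_blk_eq hn (hu.trans hb.symm) μ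
    calc |rpos n Ωc u μ - M * j μ| = |((u.1 μ : ℝ) - (x.1 μ : ℝ)) + (rpos n Ωc x μ - M * j μ)| := by
          simp only [rpos]; ring_nf
      _ ≤ |(u.1 μ : ℝ) - (x.1 μ : ℝ)| + |rpos n Ωc x μ - M * j μ| := abs_add_le _ _
      _ ≤ n + 3 / 4 * M := add_le_add h1 (hx μ)
      _ = 3 / 4 * M + n := by ring
  unfold contourTrans
  refine transport_congr (r := fun u v : ↥(fineDom n Ωc) => blk n u.1 = y.1 ∧ blk n v.1 = y.1 ∧ v.1 ∈ nbrs u.1)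
    (fun u v huv => ?_) _ _ (rstairContour_inside hn Ωc y x)
  unfold fieldLink
  rw [hAt j u v (hwin u huv.1) (hwin v huv.2.1)]

omit hK in
/-- **THE OPERATOR (1.6) IS POSITIVE DEFINITE FOR EVERY CONFIGURATION AFTER ANY BLOCK-COMPATIBLE NEUMANN CUT**: for
non-negative bond weights that agree with [B4]'s Neumann weights inside every unit block (the cut cube operators of
(2.2), the `Ω ⊂ Ω₀` cut of (1.11), their combination), `a′ > 0`, `m² ≥ 0` and any `A`, the form is strictly positive
(the block averages see every site, the staircase contours run through uncut bonds: `B4Eq16GreenExists.covOp_posDef`).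
[cite: Balaban1983RegularityDecay, (1.6) p.572, (2.2) p.575] -/
theorem covOp_blockLocal_posDef (F : OrthFlow ι) (κ : ℝ) {a m2 : ℝ} (ha : 0 < a) (hm : 0 ≤ m2)
    (c' : ↥(fineDom n Ωc) → ↥(fineDom n Ωc) → ℝ) (hc'0 : ∀ u v, 0 ≤ c' u v)
    (hc' : ∀ u v, blk n u.1 = blk n v.1 → c' u v = regWt n (fineDom n Ωc) u v)
    (B : ↥(fineDom n Ωc) → ↥(fineDom n Ωc) → ℝ) :
    (covOp c' m2 a (rBlkWt n Ωc (fineDom n Ωc)) (fieldLink F κ B)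
      (contourTrans (fieldLink F κ B) (rbaseEmb hn Ωc) (rstairContour hn Ωc))).PosDef := by
  refine covOp_posDef hc'0 hm ha (rBlkWt_nonneg n Ωc _) (rBlkWt_cover hn Ωc)
    (fun x y _ => fieldLink_orth F κ B x y) (fun y x _ => ?_) (fun y x h => rstairContour_end hn Ωc y x h)
  refine pathRel_imp_of_start (r := fun u v : ↥(fineDom n Ωc) => blk n u.1 = y.1 ∧ blk n v.1 = y.1 ∧ v.1 ∈ nbrs u.1)
    (P := fun _ => True) (fun u v _ huv => ⟨trivial, ?_⟩) _ _ trivial (rstairContour_inside hn Ωc y x)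
  rw [hc' u v (huv.1.trans huv.2.1.symm)]
  have hn0 : (0 : ℝ) < n := by exact_mod_cast hn
  simp only [regWt, huv.2.2, if_true, mul_one]
  positivity

omit hK in
/-- `hGj`: the cut cube operator of `S_j` times `G_k(□_j,Ã_j)` is the identity, for every configuration.
[cite: Balaban1983RegularityDecay, (2.2) p.575] -/
theorem cubeOp_mul_cubeGreen (F : OrthFlow ι) (κ M : ℝ) {a m2 : ℝ} (ha : 0 < a) (hm : 0 ≤ m2)
    (At : (Fin (d + 1) → ℤ) → ↥(fineDom n Ωc) → ↥(fineDom n Ωc) → ℝ) (j : Fin (d + 1) → ℤ) :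
    covOp (fun z z' => if (cubeSet n M Ωc j z ↔ cubeSet n M Ωc j z') then regWt n (fineDom n Ωc) z z' else 0) m2 a
        (rBlkWt n Ωc (fineDom n Ωc)) (fieldLink F κ (At j))
        (contourTrans (fieldLink F κ (At j)) (rbaseEmb hn Ωc) (rstairContour hn Ωc))
      * cubeGreen F κ hn M m2 a Ωc At j = 1 := by
  have hpd := covOp_blockLocal_posDef hn Ωc F κ ha hm
    (fun z z' => if (cubeSet n M Ωc j z ↔ cubeSet n M Ωc j z') then regWt n (fineDom n Ωc) z z' else 0)
    (fun u v => by
      by_cases h : (cubeSet n M Ωc j u ↔ cubeSet n M Ωc j v)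
      · rw [if_pos h]; exact regWt_nonneg n _ u v
      · rw [if_neg h])
    (fun u v huv => by
      have : (cubeSet n M Ωc j u ↔ cubeSet n M Ωc j v) := by unfold cubeSet; rw [huv]
      rw [if_pos this]) (At j)
  exact Matrix.mul_nonsing_inv _ ((Matrix.isUnit_iff_isUnit_det _).mp hpd.isUnit)

omit hK in
/-- `hGH`: `G_k(Ω,A)·(−Δ^{η,N}_{A,Ω} + m² + a′P_k(A)) = 1` for every configuration (after any block-compatible Neumann cut
of the bond weights as well). [cite: Balaban1983RegularityDecay, (1.6) p.572] -/
theorem green_mul_op (F : OrthFlow ι) (κ : ℝ) {a m2 : ℝ} (ha : 0 < a) (hm : 0 ≤ m2)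
    (c' : ↥(fineDom n Ωc) → ↥(fineDom n Ωc) → ℝ) (hc'0 : ∀ u v, 0 ≤ c' u v)
    (hc' : ∀ u v, blk n u.1 = blk n v.1 → c' u v = regWt n (fineDom n Ωc) u v)
    (B : ↥(fineDom n Ωc) → ↥(fineDom n Ωc) → ℝ) :
    (covOp c' m2 a (rBlkWt n Ωc (fineDom n Ωc)) (fieldLink F κ B)
        (contourTrans (fieldLink F κ B) (rbaseEmb hn Ωc) (rstairContour hn Ωc)))⁻¹
      * covOp c' m2 a (rBlkWt n Ωc (fineDom n Ωc)) (fieldLink F κ B)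
        (contourTrans (fieldLink F κ B) (rbaseEmb hn Ωc) (rstairContour hn Ωc)) = 1 :=
  Matrix.nonsing_inv_mul _ ((Matrix.isUnit_iff_isUnit_det _).mp
    (covOp_blockLocal_posDef hn Ωc F κ ha hm c' hc'0 hc' B).isUnit)

end Structure

/-! ## §3. The members of the Theorem p. 573 on the region carrier, modulo the per-cube analytic inputs only -/

section SubRegion

/-- THE GREEN'S FUNCTION OF A SUB-REGION `Ω ⊂ Ω₀` BY THE NEUMANN CUT (1.11): the inverse of the operator (1.6) of `Ω₀`
whose bonds crossing `∂Ω` are removed, `Ω` = the unit blocks with labels in `Ωc'` (block-diagonal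
`G_k(Ω,A) ⊕ G_k(Ω₀ ∖ Ω,A)`; the probes at sites of `Ω` see only the first block).
[cite: Balaban1983RegularityDecay, (1.11) p.573, (1.6) p.572] -/
noncomputable def greenSub (F : OrthFlow ι) (κ : ℝ) {n : ℕ} (hn : 1 ≤ n) (m2 a : ℝ)
    (Ωc Ωc' : Finset (Fin (d + 1) → ℤ)) (A : ↥(fineDom n Ωc) → ↥(fineDom n Ωc) → ℝ) :
    Matrix (↥(fineDom n Ωc) × ι) (↥(fineDom n Ωc) × ι) ℝ :=
  (covOp (fun z z' => if ((blk n z.1 ∈ Ωc') ↔ (blk n z'.1 ∈ Ωc')) then regWt n (fineDom n Ωc) z z' else 0) m2 a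
    (rBlkWt n Ωc (fineDom n Ωc)) (fieldLink F κ A)
    (contourTrans (fieldLink F κ A) (rbaseEmb hn Ωc) (rstairContour hn Ωc)))⁻¹

/-- THE CUBE PROPAGATOR OF THE SECOND FAMILY (the expansion (2.13) of `G_k(Ω,A)`, `Ω ⊂ Ω₀`): the inverse of the cut at
`∂S_j` of the `∂Ω`-cut operator, with the modified configuration `Ã_j`. [cite: Balaban1983RegularityDecay, p.579 «we take the representations (2.13) for both propagators»] -/
noncomputable def cubeGreenSub (F : OrthFlow ι) (κ : ℝ) {n : ℕ} (hn : 1 ≤ n) (M m2 a : ℝ)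
    (Ωc Ωc' : Finset (Fin (d + 1) → ℤ))
    (At : (Fin (d + 1) → ℤ) → ↥(fineDom n Ωc) → ↥(fineDom n Ωc) → ℝ) (j : Fin (d + 1) → ℤ) :
    Matrix (↥(fineDom n Ωc) × ι) (↥(fineDom n Ωc) × ι) ℝ :=
  (covOp (fun z z' => if (cubeSet n M Ωc j z ↔ cubeSet n M Ωc j z') then
      (if ((blk n z.1 ∈ Ωc') ↔ (blk n z'.1 ∈ Ωc')) then regWt n (fineDom n Ωc) z z' else 0) else 0) m2 a
    (rBlkWt n Ωc (fineDom n Ωc)) (fieldLink F κ (At j))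
    (contourTrans (fieldLink F κ (At j)) (rbaseEmb hn Ωc) (rstairContour hn Ωc)))⁻¹

end SubRegion

section Theorem

variable {n : ℕ} (hn : 1 ≤ n) (Ωc : Finset (Fin (d + 1) → ℤ)) {K : ℕ} (hK : 16 ≤ K)
  (F : OrthFlow ι) (κ : ℝ) {a m2 : ℝ} (ha : 0 < a) (hm : 0 ≤ m2)
  (A : ↥(fineDom n Ωc) → ↥(fineDom n Ωc) → ℝ)
  (At : (Fin (d + 1) → ℤ) → ↥(fineDom n Ωc) → ↥(fineDom n Ωc) → ℝ)
  (hAt : ∀ j u v, (∀ μ, |rpos n Ωc u μ - ((n : ℝ) * K) * j μ| ≤ 3 / 4 * ((n : ℝ) * K) + n) →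
    (∀ μ, |rpos n Ωc v μ - ((n : ℝ) * K) * j μ| ≤ 3 / 4 * ((n : ℝ) * K) + n) → At j u v = A u v)
include hn hK ha hm hAt

omit hn hK ha hm hAt in
/-- nearest neighbours are within `M/8` of each other in every coordinate (`M = nK ≥ 8`). [folklore] -/
private theorem nbrs_local (hn : 1 ≤ n) (hK : 16 ≤ K) {x y : ↥(fineDom n Ωc)} (hxy : y.1 ∈ nbrs x.1)
    (μ : Fin (d + 1)) : |rpos n Ωc x μ - rpos n Ωc y μ| ≤ 1 / 8 * ((n : ℝ) * K) := by
  have h1 : (1 : ℝ) ≤ n := by exact_mod_cast hn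
  have h16 : (16 : ℝ) ≤ K := by exact_mod_cast hK
  calc |rpos n Ωc x μ - rpos n Ωc y μ| ≤ 1 := abs_sub_le_one_of_mem_nbrs hxy μ
    _ ≤ 1 / 8 * ((n : ℝ) * K) := by nlinarith

/-- **THEOREM (1.10), VALUE MEMBER, FOR `G_k(Ω,A) = (−Δ^{η,N}_{A,Ω} + m² + a′P_k(A))⁻¹` ON [B4]'s REGION CARRIER, EVERY
CONFIGURATION `A`, with ONLY the per-cube inputs as hypotheses**: `Ω` = the fine region over the finite label set `Ωc`
(`B4Lower18.fineDom`), [B4]'s Neumann weights, block averages and staircase contours (`B4Lower18RegularRegion`; the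
operator is `B4GaugeCovariance.b4Op`, = `B4Lemma21Region.regionOp` for component fields), walk scale `M = nK`
(`K ≥ 16`), modified configurations `Ã_j` agreeing with `A` on the `(3/4)M + n`-windows, inputs `γ ≥ ‖G_k(□_j,Ã_j)‖`
(`cubeGreen`), `β ≥ ‖K_jG_k(□_j,Ã_j)h_j‖` over the labels, (2.21) `3^{d+1}β ≤ e⁻¹`.  Then for every site `x`, site
set `F`, `D ≤ dist_∞(x,F)`:  `‖1_x·G_k(Ω,A)·1_F‖ ≤ 2^{d+2}e^{9/4}γ·e^{−D/M}` — every structural hypothesis of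
`B4Ineq110WalkRoute.ineq110_value` discharged (§2).  HONEST SCOPE in the module docstring.
[cite: Balaban1983RegularityDecay, Theorem (1.10) p.573; (2.2), (2.13) pp.575–577] -/
theorem ineq110_value_region {γ β : ℝ} (hγ0 : 0 ≤ γ)
    (hγ : ∀ j ∈ labels ((n : ℝ) * K) n Ωc, ‖cubeGreen F κ hn ((n : ℝ) * K) m2 a Ωc At j‖ ≤ γ) (hβ0 : 0 ≤ β)
    (hβ : ∀ j ∈ labels ((n : ℝ) * K) n Ωc,
      ‖opK (fun z z' => if (cubeSet n ((n : ℝ) * K) Ωc j z ↔ cubeSet n ((n : ℝ) * K) Ωc j z')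
            then regWt n (fineDom n Ωc) z z' else 0) m2 a (rBlkWt n Ωc (fineDom n Ωc)) (fieldLink F κ (At j))
          (contourTrans (fieldLink F κ (At j)) (rbaseEmb hn Ωc) (rstairContour hn Ωc))
          (fun z => hCube ((n : ℝ) * K) j (rpos n Ωc z)) * cubeGreen F κ hn ((n : ℝ) * K) m2 a Ωc At j
        * mulH (ι := ι) (fun z => hCube ((n : ℝ) * K) j (rpos n Ωc z))‖ ≤ β)
    (h3β : (3 : ℝ) ^ (d + 1) * β ≤ Real.exp (-1))
    (x : ↥(fineDom n Ωc)) (Fs : ↥(fineDom n Ωc) → Prop) [DecidablePred Fs] {D : ℝ}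
    (hD : ∀ x', Fs x' → ∃ μ, D ≤ |rpos n Ωc x μ - rpos n Ωc x' μ|) :
    ‖mulH (ι := ι) (fun z => if z = x then (1 : ℝ) else 0)
        * (b4Op F κ (regWt n (fineDom n Ωc)) m2 a (rBlkWt n Ωc (fineDom n Ωc)) (rbaseEmb hn Ωc)
            (rstairContour hn Ωc) A)⁻¹
        * mulH (ι := ι) (fun z => if Fs z then (1 : ℝ) else 0)‖
      ≤ 2 ^ (d + 2) * Real.exp (9 / 4) * γ * Real.exp (-(D / ((n : ℝ) * K))) := by
  have hM := M_pos hn hK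
  have hK8 : 8 ≤ K := le_trans (by norm_num) hK
  have h := ineq110_value hM (rpos n Ωc) (regWt n (fineDom n Ωc)) m2 a (rBlkWt n Ωc (fineDom n Ωc))
    (fieldLink F κ A) (contourTrans (fieldLink F κ A) (rbaseEmb hn Ωc) (rstairContour hn Ωc))
    (regWt_local hn Ωc hK8) (rBlkWt_local hn Ωc hK8)
    (labels ((n : ℝ) * K) n Ωc) (fun j z hz => labels_complete Ωc _ j z hz)
    (cubeSet n ((n : ℝ) * K) Ωc) (cubeSet_of_near hn Ωc)
    (fun j => fieldLink F κ (At j))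
    (fun j => contourTrans (fieldLink F κ (At j)) (rbaseEmb hn Ωc) (rstairContour hn Ωc))
    (fun j z z' hz hz' => fieldLink_window Ωc F κ _ A At hAt j z z' hz hz')
    (fun j y z hyz hz => contourTrans_window hn Ωc F κ _ A At hAt j y z hyz hz)
    (cubeGreen F κ hn ((n : ℝ) * K) m2 a Ωc At) (fun j _ => cubeOp_mul_cubeGreen hn Ωc F κ _ ha hm At j)
    ((b4Op F κ (regWt n (fineDom n Ωc)) m2 a (rBlkWt n Ωc (fineDom n Ωc)) (rbaseEmb hn Ωc)
      (rstairContour hn Ωc) A)⁻¹)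
    (green_mul_op hn Ωc F κ ha hm (regWt n (fineDom n Ωc)) (regWt_nonneg n _) (fun _ _ _ => rfl) A)
    hγ0 (fun i => hγ i.1 i.2) hβ0 (fun i => hβ i.1 i.2) h3β x Fs hD
  exact h.trans (le_of_eq (by ring))

/-- **THEOREM (1.10), DERIVATIVE MEMBER, ON THE REGION CARRIER**: for a nearest-neighbour bond `b = ⟨x, y⟩` of the
region, `w ≥` the row sums of `|U(A_b)|`, inputs `γ`, `γ′ ≥ ‖P_bG_k(□_j,Ã_j)‖`, `β`:
`‖P_b·G_k(Ω,A)·1_F‖ ≤ 2^{d+3}e^{19/8}(γ′ + (1 + w)γ)·e^{−D/M}` (`B4Ineq110WalkRouteDeriv.ineq110_deriv` with its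
structural hypotheses discharged). [cite: Balaban1983RegularityDecay, Theorem (1.10) p.573; (2.13) p.577; (2.20)–(2.22) pp.578–579] -/
theorem ineq110_deriv_region (x y : ↥(fineDom n Ωc)) (hxy : y.1 ∈ nbrs x.1) {w : ℝ} (hw0 : 0 ≤ w)
    (hw : ∀ k, ∑ k', |fieldLink F κ A x y k k'| ≤ w)
    {γ γ' β : ℝ} (hγ0 : 0 ≤ γ)
    (hγ : ∀ j ∈ labels ((n : ℝ) * K) n Ωc, ‖cubeGreen F κ hn ((n : ℝ) * K) m2 a Ωc At j‖ ≤ γ) (hγ'0 : 0 ≤ γ')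
    (hγ' : ∀ j ∈ labels ((n : ℝ) * K) n Ωc,
      ‖(unitOp x y (fieldLink F κ A x y) - unitOp x x 1) * cubeGreen F κ hn ((n : ℝ) * K) m2 a Ωc At j‖ ≤ γ')
    (hβ0 : 0 ≤ β)
    (hβ : ∀ j ∈ labels ((n : ℝ) * K) n Ωc,
      ‖opK (fun z z' => if (cubeSet n ((n : ℝ) * K) Ωc j z ↔ cubeSet n ((n : ℝ) * K) Ωc j z')
            then regWt n (fineDom n Ωc) z z' else 0) m2 a (rBlkWt n Ωc (fineDom n Ωc)) (fieldLink F κ (At j))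
          (contourTrans (fieldLink F κ (At j)) (rbaseEmb hn Ωc) (rstairContour hn Ωc))
          (fun z => hCube ((n : ℝ) * K) j (rpos n Ωc z)) * cubeGreen F κ hn ((n : ℝ) * K) m2 a Ωc At j
        * mulH (ι := ι) (fun z => hCube ((n : ℝ) * K) j (rpos n Ωc z))‖ ≤ β)
    (h3β : (3 : ℝ) ^ (d + 1) * β ≤ Real.exp (-1))
    (Fs : ↥(fineDom n Ωc) → Prop) [DecidablePred Fs] {D : ℝ}
    (hD : ∀ x', Fs x' → ∃ μ, D ≤ |rpos n Ωc x μ - rpos n Ωc x' μ|) :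
    ‖(unitOp x y (fieldLink F κ A x y) - unitOp x x 1)
        * (b4Op F κ (regWt n (fineDom n Ωc)) m2 a (rBlkWt n Ωc (fineDom n Ωc)) (rbaseEmb hn Ωc)
            (rstairContour hn Ωc) A)⁻¹
        * mulH (ι := ι) (fun z => if Fs z then (1 : ℝ) else 0)‖
      ≤ 2 ^ (d + 3) * Real.exp (19 / 8) * (γ' + (1 + w) * γ) * Real.exp (-(D / ((n : ℝ) * K))) := by
  have hM := M_pos hn hK
  have hK8 : 8 ≤ K := le_trans (by norm_num) hK
  have h := ineq110_deriv hM (rpos n Ωc) (regWt n (fineDom n Ωc)) m2 a (rBlkWt n Ωc (fineDom n Ωc))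
    (fieldLink F κ A) (contourTrans (fieldLink F κ A) (rbaseEmb hn Ωc) (rstairContour hn Ωc))
    (regWt_local hn Ωc hK8) (rBlkWt_local hn Ωc hK8)
    (labels ((n : ℝ) * K) n Ωc) (fun j z hz => labels_complete Ωc _ j z hz)
    (cubeSet n ((n : ℝ) * K) Ωc) (cubeSet_of_near hn Ωc)
    (fun j => fieldLink F κ (At j))
    (fun j => contourTrans (fieldLink F κ (At j)) (rbaseEmb hn Ωc) (rstairContour hn Ωc))
    (fun j z z' hz hz' => fieldLink_window Ωc F κ _ A At hAt j z z' hz hz')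
    (fun j y z hyz hz => contourTrans_window hn Ωc F κ _ A At hAt j y z hyz hz)
    (cubeGreen F κ hn ((n : ℝ) * K) m2 a Ωc At) (fun j _ => cubeOp_mul_cubeGreen hn Ωc F κ _ ha hm At j)
    ((b4Op F κ (regWt n (fineDom n Ωc)) m2 a (rBlkWt n Ωc (fineDom n Ωc)) (rbaseEmb hn Ωc)
      (rstairContour hn Ωc) A)⁻¹)
    (green_mul_op hn Ωc F κ ha hm (regWt n (fineDom n Ωc)) (regWt_nonneg n _) (fun _ _ _ => rfl) A)
    x y (nbrs_local Ωc hn hK hxy) hw0 hw hγ0 (fun i => hγ i.1 i.2) hγ'0 (fun i => hγ' i.1 i.2) hβ0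
    (fun i => hβ i.1 i.2) h3β Fs hD
  exact h.trans (le_of_eq (by ring))

/-- **THEOREM (1.9), HÖLDER MEMBER, ON THE REGION CARRIER**: for two nearest-neighbour bonds `b = ⟨x,y⟩`, `b′ = ⟨x′,y′⟩`
with `|x − x′|_∞ ≤ M/8`, ANY weight `σ` (= `|x−x′|^{−α}`) and ANY transport `U` (= `U(A(Γ_{x,x′}))`), the per-cube Hölder
input `γ_H ≥ ‖P_H·h_jG_k(□_j,Ã_j)h_j‖` (print: `c₁` of (2.18)) and `β`:
`‖P_H·G_k(Ω,A)·1_F‖ ≤ 2^{d+4}e^{5/2}γ_H·e^{−D/M}` (`B4Ineq19WalkRoute.ineq19_holder` with its structural hypotheses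
discharged). [cite: Balaban1983RegularityDecay, Theorem (1.9) p.573; (2.14) p.577; (2.18) p.578] -/
theorem ineq19_holder_region (x y x' y' : ↥(fineDom n Ωc)) (hxy : y.1 ∈ nbrs x.1) (hx'y' : y'.1 ∈ nbrs x'.1)
    (hxx' : ∀ μ, |rpos n Ωc x μ - rpos n Ωc x' μ| ≤ 1 / 8 * ((n : ℝ) * K)) (σ : ℝ) (U : Matrix ι ι ℝ)
    {γH β : ℝ} (hγH0 : 0 ≤ γH)
    (hγH : ∀ j ∈ labels ((n : ℝ) * K) n Ωc,
      ‖σ • (unitOp x y' (U * fieldLink F κ A x' y') - unitOp x x' U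
            - (unitOp x y (fieldLink F κ A x y) - unitOp x x 1))
        * (mulH (ι := ι) (fun z => hCube ((n : ℝ) * K) j (rpos n Ωc z)) * cubeGreen F κ hn ((n : ℝ) * K) m2 a Ωc At j
          * mulH (ι := ι) (fun z => hCube ((n : ℝ) * K) j (rpos n Ωc z)))‖ ≤ γH)
    (hβ0 : 0 ≤ β)
    (hβ : ∀ j ∈ labels ((n : ℝ) * K) n Ωc,
      ‖opK (fun z z' => if (cubeSet n ((n : ℝ) * K) Ωc j z ↔ cubeSet n ((n : ℝ) * K) Ωc j z')
            then regWt n (fineDom n Ωc) z z' else 0) m2 a (rBlkWt n Ωc (fineDom n Ωc)) (fieldLink F κ (At j))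
          (contourTrans (fieldLink F κ (At j)) (rbaseEmb hn Ωc) (rstairContour hn Ωc))
          (fun z => hCube ((n : ℝ) * K) j (rpos n Ωc z)) * cubeGreen F κ hn ((n : ℝ) * K) m2 a Ωc At j
        * mulH (ι := ι) (fun z => hCube ((n : ℝ) * K) j (rpos n Ωc z))‖ ≤ β)
    (h3β : (3 : ℝ) ^ (d + 1) * β ≤ Real.exp (-1))
    (Fs : ↥(fineDom n Ωc) → Prop) [DecidablePred Fs] {D : ℝ}
    (hD : ∀ x'', Fs x'' → ∃ μ, D ≤ |rpos n Ωc x μ - rpos n Ωc x'' μ|) :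
    ‖σ • (unitOp x y' (U * fieldLink F κ A x' y') - unitOp x x' U
          - (unitOp x y (fieldLink F κ A x y) - unitOp x x 1))
        * (b4Op F κ (regWt n (fineDom n Ωc)) m2 a (rBlkWt n Ωc (fineDom n Ωc)) (rbaseEmb hn Ωc)
            (rstairContour hn Ωc) A)⁻¹
        * mulH (ι := ι) (fun z => if Fs z then (1 : ℝ) else 0)‖
      ≤ 2 ^ (d + 4) * Real.exp (5 / 2) * γH * Real.exp (-(D / ((n : ℝ) * K))) := by
  have hM := M_pos hn hK
  have hK8 : 8 ≤ K := le_trans (by norm_num) hK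
  have h := ineq19_holder hM (rpos n Ωc) (regWt n (fineDom n Ωc)) m2 a (rBlkWt n Ωc (fineDom n Ωc))
    (fieldLink F κ A) (contourTrans (fieldLink F κ A) (rbaseEmb hn Ωc) (rstairContour hn Ωc))
    (regWt_local hn Ωc hK8) (rBlkWt_local hn Ωc hK8)
    (labels ((n : ℝ) * K) n Ωc) (fun j z hz => labels_complete Ωc _ j z hz)
    (cubeSet n ((n : ℝ) * K) Ωc) (cubeSet_of_near hn Ωc)
    (fun j => fieldLink F κ (At j))
    (fun j => contourTrans (fieldLink F κ (At j)) (rbaseEmb hn Ωc) (rstairContour hn Ωc))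
    (fun j z z' hz hz' => fieldLink_window Ωc F κ _ A At hAt j z z' hz hz')
    (fun j y z hyz hz => contourTrans_window hn Ωc F κ _ A At hAt j y z hyz hz)
    (cubeGreen F κ hn ((n : ℝ) * K) m2 a Ωc At) (fun j _ => cubeOp_mul_cubeGreen hn Ωc F κ _ ha hm At j)
    ((b4Op F κ (regWt n (fineDom n Ωc)) m2 a (rBlkWt n Ωc (fineDom n Ωc)) (rbaseEmb hn Ωc)
      (rstairContour hn Ωc) A)⁻¹)
    (green_mul_op hn Ωc F κ ha hm (regWt n (fineDom n Ωc)) (regWt_nonneg n _) (fun _ _ _ => rfl) A)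
    x y x' y' (nbrs_local Ωc hn hK hxy) hxx' (nbrs_local Ωc hn hK hx'y') σ U hγH0 (fun i => hγH i.1 i.2) hβ0
    (fun i => hβ i.1 i.2) h3β Fs hD
  exact h.trans (le_of_eq (by ring))

/-- **THEOREM (1.11)–(1.12), VALUE MEMBER, ON THE REGION CARRIER**: `Ω₀` = the fine region over `Ωc`, `Ω` = its unit
blocks with labels in `Ωc'` entering through the Neumann cut at `∂Ω` (`greenSub` = `G_k(Ω,A) ⊕ G_k(Ω₀∖Ω,A)`), the two
cube families `cubeGreen` / `cubeGreenSub` with inputs `γ`, `β` for both, (2.21) `3^{d+1}β ≤ e⁻¹`.  For every site `x`,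
site set `F`, `D ≤ dist_∞(x,F)`, `D₀ ≤ dist_∞(x,Ω^c)`, `D₁ ≤ dist_∞(F,Ω^c)` (`Ω^c` = the sites of `Ω₀` outside `Ω`):
`‖1_x·(G_k(Ω,A) − G_k(Ω₀,A))·1_F‖ ≤ 2^{d+3}e^{17/4}γ·exp(−(D + D₀ + D₁)/(2M))` (`B4Ineq112WalkRoute.ineq112_value` with
its structural hypotheses discharged; the derivative and Hölder members of the δG clause follow the same way from
`B4Ineq112WalkRouteDeriv.ineq112_deriv` / `B4Ineq19WalkRoute.ineq112_holder`).
[cite: Balaban1983RegularityDecay, Theorem (1.11)–(1.12) p.573; p.579] -/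
theorem ineq112_value_region (Ωc' : Finset (Fin (d + 1) → ℤ)) {γ β : ℝ} (hγ0 : 0 ≤ γ)
    (hγ : ∀ j ∈ labels ((n : ℝ) * K) n Ωc, ‖cubeGreen F κ hn ((n : ℝ) * K) m2 a Ωc At j‖ ≤ γ)
    (hγΩ : ∀ j ∈ labels ((n : ℝ) * K) n Ωc, ‖cubeGreenSub F κ hn ((n : ℝ) * K) m2 a Ωc Ωc' At j‖ ≤ γ)
    (hβ0 : 0 ≤ β)
    (hβ : ∀ j ∈ labels ((n : ℝ) * K) n Ωc,
      ‖opK (fun z z' => if (cubeSet n ((n : ℝ) * K) Ωc j z ↔ cubeSet n ((n : ℝ) * K) Ωc j z')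
            then regWt n (fineDom n Ωc) z z' else 0) m2 a (rBlkWt n Ωc (fineDom n Ωc)) (fieldLink F κ (At j))
          (contourTrans (fieldLink F κ (At j)) (rbaseEmb hn Ωc) (rstairContour hn Ωc))
          (fun z => hCube ((n : ℝ) * K) j (rpos n Ωc z)) * cubeGreen F κ hn ((n : ℝ) * K) m2 a Ωc At j
        * mulH (ι := ι) (fun z => hCube ((n : ℝ) * K) j (rpos n Ωc z))‖ ≤ β)
    (hβΩ : ∀ j ∈ labels ((n : ℝ) * K) n Ωc,
      ‖opK (fun z z' => if (cubeSet n ((n : ℝ) * K) Ωc j z ↔ cubeSet n ((n : ℝ) * K) Ωc j z')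
            then (if ((blk n z.1 ∈ Ωc') ↔ (blk n z'.1 ∈ Ωc')) then regWt n (fineDom n Ωc) z z' else 0) else 0)
          m2 a (rBlkWt n Ωc (fineDom n Ωc)) (fieldLink F κ (At j))
          (contourTrans (fieldLink F κ (At j)) (rbaseEmb hn Ωc) (rstairContour hn Ωc))
          (fun z => hCube ((n : ℝ) * K) j (rpos n Ωc z)) * cubeGreenSub F κ hn ((n : ℝ) * K) m2 a Ωc Ωc' At j
        * mulH (ι := ι) (fun z => hCube ((n : ℝ) * K) j (rpos n Ωc z))‖ ≤ β)
    (h3β : (3 : ℝ) ^ (d + 1) * β ≤ Real.exp (-1))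
    (x : ↥(fineDom n Ωc)) (Fs : ↥(fineDom n Ωc) → Prop) [DecidablePred Fs] {D D₀ D₁ : ℝ}
    (hD : ∀ x', Fs x' → ∃ μ, D ≤ |rpos n Ωc x μ - rpos n Ωc x' μ|)
    (hD₀ : ∀ x₁ : ↥(fineDom n Ωc), blk n x₁.1 ∉ Ωc' → ∃ μ, D₀ ≤ |rpos n Ωc x μ - rpos n Ωc x₁ μ|)
    (hD₁ : ∀ x', Fs x' → ∀ x₁ : ↥(fineDom n Ωc), blk n x₁.1 ∉ Ωc' → ∃ μ, D₁ ≤ |rpos n Ωc x₁ μ - rpos n Ωc x' μ|) :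
    ‖mulH (ι := ι) (fun z => if z = x then (1 : ℝ) else 0)
        * (greenSub F κ hn m2 a Ωc Ωc' A
          - (b4Op F κ (regWt n (fineDom n Ωc)) m2 a (rBlkWt n Ωc (fineDom n Ωc)) (rbaseEmb hn Ωc)
              (rstairContour hn Ωc) A)⁻¹)
        * mulH (ι := ι) (fun z => if Fs z then (1 : ℝ) else 0)‖
      ≤ 2 ^ (d + 3) * Real.exp (17 / 4) * γ * Real.exp (-((D + D₀ + D₁) / (2 * ((n : ℝ) * K)))) := by
  have hM := M_pos hn hK
  have hK8 : 8 ≤ K := le_trans (by norm_num) hK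
  -- the two Neumann cuts are block-local
  have hcΩ0 : ∀ u v : ↥(fineDom n Ωc),
      0 ≤ (if ((blk n u.1 ∈ Ωc') ↔ (blk n v.1 ∈ Ωc')) then regWt n (fineDom n Ωc) u v else 0) := by
    intro u v
    by_cases h : ((blk n u.1 ∈ Ωc') ↔ (blk n v.1 ∈ Ωc'))
    · rw [if_pos h]; exact regWt_nonneg n _ u v
    · rw [if_neg h]
  have hcΩ : ∀ u v : ↥(fineDom n Ωc), blk n u.1 = blk n v.1 →
      (if ((blk n u.1 ∈ Ωc') ↔ (blk n v.1 ∈ Ωc')) then regWt n (fineDom n Ωc) u v else 0)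
        = regWt n (fineDom n Ωc) u v := by
    intro u v huv
    rw [if_pos (by rw [huv])]
  have hGjΩ : ∀ j : Fin (d + 1) → ℤ,
      covOp (fun z z' => if (cubeSet n ((n : ℝ) * K) Ωc j z ↔ cubeSet n ((n : ℝ) * K) Ωc j z')
            then (if ((blk n z.1 ∈ Ωc') ↔ (blk n z'.1 ∈ Ωc')) then regWt n (fineDom n Ωc) z z' else 0) else 0)
          m2 a (rBlkWt n Ωc (fineDom n Ωc)) (fieldLink F κ (At j))
          (contourTrans (fieldLink F κ (At j)) (rbaseEmb hn Ωc) (rstairContour hn Ωc))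
        * cubeGreenSub F κ hn ((n : ℝ) * K) m2 a Ωc Ωc' At j = 1 := by
    intro j
    have hpd := covOp_blockLocal_posDef hn Ωc F κ ha hm
      (fun z z' => if (cubeSet n ((n : ℝ) * K) Ωc j z ↔ cubeSet n ((n : ℝ) * K) Ωc j z')
        then (if ((blk n z.1 ∈ Ωc') ↔ (blk n z'.1 ∈ Ωc')) then regWt n (fineDom n Ωc) z z' else 0) else 0)
      (fun u v => by
        by_cases h : (cubeSet n ((n : ℝ) * K) Ωc j u ↔ cubeSet n ((n : ℝ) * K) Ωc j v)
        · rw [if_pos h]; exact hcΩ0 u v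
        · rw [if_neg h])
      (fun u v huv => by
        have : (cubeSet n ((n : ℝ) * K) Ωc j u ↔ cubeSet n ((n : ℝ) * K) Ωc j v) := by unfold cubeSet; rw [huv]
        rw [if_pos this, hcΩ u v huv]) (At j)
    exact Matrix.mul_nonsing_inv _ ((Matrix.isUnit_iff_isUnit_det _).mp hpd.isUnit)
  have h := ineq112_value hM (rpos n Ωc) (regWt n (fineDom n Ωc)) m2 a (rBlkWt n Ωc (fineDom n Ωc))
    (fieldLink F κ A) (contourTrans (fieldLink F κ A) (rbaseEmb hn Ωc) (rstairContour hn Ωc))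
    (regWt_local hn Ωc hK8) (rBlkWt_local hn Ωc hK8)
    (labels ((n : ℝ) * K) n Ωc) (fun j z hz => labels_complete Ωc _ j z hz)
    (cubeSet n ((n : ℝ) * K) Ωc) (cubeSet_of_near hn Ωc) (near_of_cubeSet hn Ωc hK)
    (fun j y z z' hz hz' => cubeSet_iff_of_blk Ωc _ j y z z' hz hz')
    (fun j => fieldLink F κ (At j))
    (fun j => contourTrans (fieldLink F κ (At j)) (rbaseEmb hn Ωc) (rstairContour hn Ωc))
    (fun j z z' hz hz' => fieldLink_window Ωc F κ _ A At hAt j z z' hz hz')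
    (fun j y z hyz hz => contourTrans_window hn Ωc F κ _ A At hAt j y z hyz hz)
    (fun z : ↥(fineDom n Ωc) => blk n z.1 ∈ Ωc')
    (cubeGreen F κ hn ((n : ℝ) * K) m2 a Ωc At) (fun j _ => cubeOp_mul_cubeGreen hn Ωc F κ _ ha hm At j)
    (cubeGreenSub F κ hn ((n : ℝ) * K) m2 a Ωc Ωc' At) (fun j _ => hGjΩ j)
    (greenSub F κ hn m2 a Ωc Ωc' A) (green_mul_op hn Ωc F κ ha hm _ hcΩ0 hcΩ A)
    ((b4Op F κ (regWt n (fineDom n Ωc)) m2 a (rBlkWt n Ωc (fineDom n Ωc)) (rbaseEmb hn Ωc)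
      (rstairContour hn Ωc) A)⁻¹)
    (green_mul_op hn Ωc F κ ha hm (regWt n (fineDom n Ωc)) (regWt_nonneg n _) (fun _ _ _ => rfl) A)
    hγ0 (fun i => hγ i.1 i.2) (fun i => hγΩ i.1 i.2) hβ0 (fun i => hβ i.1 i.2) (fun i => hβΩ i.1 i.2) h3β x Fs
    hD (fun x₁ hx₁ => hD₀ x₁ hx₁) (fun x' hx' x₁ hx₁ => hD₁ x' hx' x₁ hx₁)
  exact h.trans (le_of_eq (by ring))

/-! ### v1.1: the derivative and Hölder members of the δG clause on the region carrier -/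

omit hK hAt in
/-- `hGj` for the second cube family: the doubly cut cube operator (cuts at `∂S_j` and at `∂Ω`) times `cubeGreenSub` is
the identity, for every configuration. [cite: Balaban1983RegularityDecay, p.579 «the representations (2.13) for both propagators»] -/
theorem cubeOpSub_mul_cubeGreenSub (M : ℝ) (Ωc' : Finset (Fin (d + 1) → ℤ)) (j : Fin (d + 1) → ℤ) :
    covOp (fun z z' => if (cubeSet n M Ωc j z ↔ cubeSet n M Ωc j z')
          then (if ((blk n z.1 ∈ Ωc') ↔ (blk n z'.1 ∈ Ωc')) then regWt n (fineDom n Ωc) z z' else 0) else 0)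
        m2 a (rBlkWt n Ωc (fineDom n Ωc)) (fieldLink F κ (At j))
        (contourTrans (fieldLink F κ (At j)) (rbaseEmb hn Ωc) (rstairContour hn Ωc))
      * cubeGreenSub F κ hn M m2 a Ωc Ωc' At j = 1 := by
  have hpd := covOp_blockLocal_posDef hn Ωc F κ ha hm
    (fun z z' => if (cubeSet n M Ωc j z ↔ cubeSet n M Ωc j z')
      then (if ((blk n z.1 ∈ Ωc') ↔ (blk n z'.1 ∈ Ωc')) then regWt n (fineDom n Ωc) z z' else 0) else 0)
    (fun u v => by
      by_cases h : (cubeSet n M Ωc j u ↔ cubeSet n M Ωc j v)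
      · rw [if_pos h]
        by_cases h' : ((blk n u.1 ∈ Ωc') ↔ (blk n v.1 ∈ Ωc'))
        · rw [if_pos h']; exact regWt_nonneg n _ u v
        · rw [if_neg h']
      · rw [if_neg h])
    (fun u v huv => by
      have h1 : (cubeSet n M Ωc j u ↔ cubeSet n M Ωc j v) := by unfold cubeSet; rw [huv]
      have h2 : ((blk n u.1 ∈ Ωc') ↔ (blk n v.1 ∈ Ωc')) := by rw [huv]
      rw [if_pos h1, if_pos h2]) (At j)
  exact Matrix.mul_nonsing_inv _ ((Matrix.isUnit_iff_isUnit_det _).mp hpd.isUnit)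

omit hK hAt in
/-- `hGH` for the sub-region: `G_k(Ω,A)` (`greenSub`, Neumann cut at `∂Ω`) times its operator is the identity, for every
configuration. [cite: Balaban1983RegularityDecay, (1.11) p.573, (1.6) p.572] -/
theorem greenSub_mul_op (Ωc' : Finset (Fin (d + 1) → ℤ)) :
    greenSub F κ hn m2 a Ωc Ωc' A
      * covOp (fun z z' => if ((blk n z.1 ∈ Ωc') ↔ (blk n z'.1 ∈ Ωc')) then regWt n (fineDom n Ωc) z z' else 0)
          m2 a (rBlkWt n Ωc (fineDom n Ωc)) (fieldLink F κ A)
          (contourTrans (fieldLink F κ A) (rbaseEmb hn Ωc) (rstairContour hn Ωc)) = 1 :=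
  green_mul_op hn Ωc F κ ha hm _
    (fun u v => by
      by_cases h : ((blk n u.1 ∈ Ωc') ↔ (blk n v.1 ∈ Ωc'))
      · rw [if_pos h]; exact regWt_nonneg n _ u v
      · rw [if_neg h])
    (fun u v huv => by rw [if_pos (by rw [huv])]) A

/-- **THEOREM (1.11)–(1.12), DERIVATIVE MEMBER, ON THE REGION CARRIER** (setting of `ineq112_value_region`, bond
`b = ⟨x,y⟩` with `y ∈ nbrs x`, inputs `γ`, `γ′`, `β` for both cube families):
`‖P_b·(G_k(Ω,A) − G_k(Ω₀,A))·1_F‖ ≤ 2^{d+4}e^{35/8}(γ′ + (1 + w)γ)·exp(−(D + D₀ + D₁)/(2M))`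
(`B4Ineq112WalkRouteDeriv.ineq112_deriv` with its structural hypotheses discharged).
[cite: Balaban1983RegularityDecay, Theorem (1.10)–(1.12) p.573; p.579] -/
theorem ineq112_deriv_region (Ωc' : Finset (Fin (d + 1) → ℤ)) (x y : ↥(fineDom n Ωc)) (hxy : y.1 ∈ nbrs x.1)
    {w : ℝ} (hw0 : 0 ≤ w) (hw : ∀ k, ∑ k', |fieldLink F κ A x y k k'| ≤ w)
    {γ γ' β : ℝ} (hγ0 : 0 ≤ γ)
    (hγ : ∀ j ∈ labels ((n : ℝ) * K) n Ωc, ‖cubeGreen F κ hn ((n : ℝ) * K) m2 a Ωc At j‖ ≤ γ)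
    (hγΩ : ∀ j ∈ labels ((n : ℝ) * K) n Ωc, ‖cubeGreenSub F κ hn ((n : ℝ) * K) m2 a Ωc Ωc' At j‖ ≤ γ)
    (hγ'0 : 0 ≤ γ')
    (hγ' : ∀ j ∈ labels ((n : ℝ) * K) n Ωc,
      ‖(unitOp x y (fieldLink F κ A x y) - unitOp x x 1) * cubeGreen F κ hn ((n : ℝ) * K) m2 a Ωc At j‖ ≤ γ')
    (hγ'Ω : ∀ j ∈ labels ((n : ℝ) * K) n Ωc,
      ‖(unitOp x y (fieldLink F κ A x y) - unitOp x x 1) * cubeGreenSub F κ hn ((n : ℝ) * K) m2 a Ωc Ωc' At j‖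
        ≤ γ')
    (hβ0 : 0 ≤ β)
    (hβ : ∀ j ∈ labels ((n : ℝ) * K) n Ωc,
      ‖opK (fun z z' => if (cubeSet n ((n : ℝ) * K) Ωc j z ↔ cubeSet n ((n : ℝ) * K) Ωc j z')
            then regWt n (fineDom n Ωc) z z' else 0) m2 a (rBlkWt n Ωc (fineDom n Ωc)) (fieldLink F κ (At j))
          (contourTrans (fieldLink F κ (At j)) (rbaseEmb hn Ωc) (rstairContour hn Ωc))
          (fun z => hCube ((n : ℝ) * K) j (rpos n Ωc z)) * cubeGreen F κ hn ((n : ℝ) * K) m2 a Ωc At j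
        * mulH (ι := ι) (fun z => hCube ((n : ℝ) * K) j (rpos n Ωc z))‖ ≤ β)
    (hβΩ : ∀ j ∈ labels ((n : ℝ) * K) n Ωc,
      ‖opK (fun z z' => if (cubeSet n ((n : ℝ) * K) Ωc j z ↔ cubeSet n ((n : ℝ) * K) Ωc j z')
            then (if ((blk n z.1 ∈ Ωc') ↔ (blk n z'.1 ∈ Ωc')) then regWt n (fineDom n Ωc) z z' else 0) else 0)
          m2 a (rBlkWt n Ωc (fineDom n Ωc)) (fieldLink F κ (At j))
          (contourTrans (fieldLink F κ (At j)) (rbaseEmb hn Ωc) (rstairContour hn Ωc))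
          (fun z => hCube ((n : ℝ) * K) j (rpos n Ωc z)) * cubeGreenSub F κ hn ((n : ℝ) * K) m2 a Ωc Ωc' At j
        * mulH (ι := ι) (fun z => hCube ((n : ℝ) * K) j (rpos n Ωc z))‖ ≤ β)
    (h3β : (3 : ℝ) ^ (d + 1) * β ≤ Real.exp (-1))
    (Fs : ↥(fineDom n Ωc) → Prop) [DecidablePred Fs] {D D₀ D₁ : ℝ}
    (hD : ∀ x', Fs x' → ∃ μ, D ≤ |rpos n Ωc x μ - rpos n Ωc x' μ|)
    (hD₀ : ∀ x₁ : ↥(fineDom n Ωc), blk n x₁.1 ∉ Ωc' → ∃ μ, D₀ ≤ |rpos n Ωc x μ - rpos n Ωc x₁ μ|)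
    (hD₁ : ∀ x', Fs x' → ∀ x₁ : ↥(fineDom n Ωc), blk n x₁.1 ∉ Ωc' → ∃ μ, D₁ ≤ |rpos n Ωc x₁ μ - rpos n Ωc x' μ|) :
    ‖(unitOp x y (fieldLink F κ A x y) - unitOp x x 1)
        * (greenSub F κ hn m2 a Ωc Ωc' A
          - (b4Op F κ (regWt n (fineDom n Ωc)) m2 a (rBlkWt n Ωc (fineDom n Ωc)) (rbaseEmb hn Ωc)
              (rstairContour hn Ωc) A)⁻¹)
        * mulH (ι := ι) (fun z => if Fs z then (1 : ℝ) else 0)‖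
      ≤ 2 ^ (d + 4) * Real.exp (35 / 8) * (γ' + (1 + w) * γ) * Real.exp (-((D + D₀ + D₁) / (2 * ((n : ℝ) * K)))) := by
  have hM := M_pos hn hK
  have hK8 : 8 ≤ K := le_trans (by norm_num) hK
  have h := ineq112_deriv hM (rpos n Ωc) (regWt n (fineDom n Ωc)) m2 a (rBlkWt n Ωc (fineDom n Ωc))
    (fieldLink F κ A) (contourTrans (fieldLink F κ A) (rbaseEmb hn Ωc) (rstairContour hn Ωc))
    (regWt_local hn Ωc hK8) (rBlkWt_local hn Ωc hK8)
    (labels ((n : ℝ) * K) n Ωc) (fun j z hz => labels_complete Ωc _ j z hz)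
    (cubeSet n ((n : ℝ) * K) Ωc) (cubeSet_of_near hn Ωc) (near_of_cubeSet hn Ωc hK)
    (fun j y z z' hz hz' => cubeSet_iff_of_blk Ωc _ j y z z' hz hz')
    (fun j => fieldLink F κ (At j))
    (fun j => contourTrans (fieldLink F κ (At j)) (rbaseEmb hn Ωc) (rstairContour hn Ωc))
    (fun j z z' hz hz' => fieldLink_window Ωc F κ _ A At hAt j z z' hz hz')
    (fun j y z hyz hz => contourTrans_window hn Ωc F κ _ A At hAt j y z hyz hz)
    (fun z : ↥(fineDom n Ωc) => blk n z.1 ∈ Ωc')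
    (cubeGreen F κ hn ((n : ℝ) * K) m2 a Ωc At) (fun j _ => cubeOp_mul_cubeGreen hn Ωc F κ _ ha hm At j)
    (cubeGreenSub F κ hn ((n : ℝ) * K) m2 a Ωc Ωc' At)
    (fun j _ => cubeOpSub_mul_cubeGreenSub hn Ωc F κ ha hm At _ Ωc' j)
    (greenSub F κ hn m2 a Ωc Ωc' A) (greenSub_mul_op hn Ωc F κ ha hm A Ωc')
    ((b4Op F κ (regWt n (fineDom n Ωc)) m2 a (rBlkWt n Ωc (fineDom n Ωc)) (rbaseEmb hn Ωc)
      (rstairContour hn Ωc) A)⁻¹)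
    (green_mul_op hn Ωc F κ ha hm (regWt n (fineDom n Ωc)) (regWt_nonneg n _) (fun _ _ _ => rfl) A)
    x y (nbrs_local Ωc hn hK hxy) hw0 hw hγ0 (fun i => hγ i.1 i.2) (fun i => hγΩ i.1 i.2) hγ'0
    (fun i => hγ' i.1 i.2) (fun i => hγ'Ω i.1 i.2) hβ0 (fun i => hβ i.1 i.2) (fun i => hβΩ i.1 i.2) h3β Fs
    hD (fun x₁ hx₁ => hD₀ x₁ hx₁) (fun x' hx' x₁ hx₁ => hD₁ x' hx' x₁ hx₁)
  exact h.trans (le_of_eq (by ring))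

/-- **THE HÖLDER MEMBER OF (1.11)–(1.12) ON THE REGION CARRIER** (setting of `ineq112_value_region`, two nearest-neighbour
bonds `⟨x,y⟩`, `⟨x′,y′⟩` with `|x − x′|_∞ ≤ M/8`, any `σ`, `U`, the Hölder input `γ_H` for both cube families, `β`):
`‖P_H·(G_k(Ω,A) − G_k(Ω₀,A))·1_F‖ ≤ 2^{d+5}e^{9/2}γ_H·exp(−(D + D₀ + D₁)/(2M))` (`B4Ineq19WalkRoute.ineq112_holder` with
its structural hypotheses discharged). [cite: Balaban1983RegularityDecay, Theorem (1.9), (1.11)–(1.12) p.573; p.579] -/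
theorem ineq112_holder_region (Ωc' : Finset (Fin (d + 1) → ℤ)) (x y x' y' : ↥(fineDom n Ωc)) (hxy : y.1 ∈ nbrs x.1)
    (hx'y' : y'.1 ∈ nbrs x'.1) (hxx' : ∀ μ, |rpos n Ωc x μ - rpos n Ωc x' μ| ≤ 1 / 8 * ((n : ℝ) * K)) (σ : ℝ)
    (U : Matrix ι ι ℝ) {γH β : ℝ} (hγH0 : 0 ≤ γH)
    (hγH : ∀ j ∈ labels ((n : ℝ) * K) n Ωc,
      ‖σ • (unitOp x y' (U * fieldLink F κ A x' y') - unitOp x x' U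
            - (unitOp x y (fieldLink F κ A x y) - unitOp x x 1))
        * (mulH (ι := ι) (fun z => hCube ((n : ℝ) * K) j (rpos n Ωc z)) * cubeGreen F κ hn ((n : ℝ) * K) m2 a Ωc At j
          * mulH (ι := ι) (fun z => hCube ((n : ℝ) * K) j (rpos n Ωc z)))‖ ≤ γH)
    (hγHΩ : ∀ j ∈ labels ((n : ℝ) * K) n Ωc,
      ‖σ • (unitOp x y' (U * fieldLink F κ A x' y') - unitOp x x' U
            - (unitOp x y (fieldLink F κ A x y) - unitOp x x 1))
        * (mulH (ι := ι) (fun z => hCube ((n : ℝ) * K) j (rpos n Ωc z))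
          * cubeGreenSub F κ hn ((n : ℝ) * K) m2 a Ωc Ωc' At j
          * mulH (ι := ι) (fun z => hCube ((n : ℝ) * K) j (rpos n Ωc z)))‖ ≤ γH)
    (hβ0 : 0 ≤ β)
    (hβ : ∀ j ∈ labels ((n : ℝ) * K) n Ωc,
      ‖opK (fun z z' => if (cubeSet n ((n : ℝ) * K) Ωc j z ↔ cubeSet n ((n : ℝ) * K) Ωc j z')
            then regWt n (fineDom n Ωc) z z' else 0) m2 a (rBlkWt n Ωc (fineDom n Ωc)) (fieldLink F κ (At j))
          (contourTrans (fieldLink F κ (At j)) (rbaseEmb hn Ωc) (rstairContour hn Ωc))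
          (fun z => hCube ((n : ℝ) * K) j (rpos n Ωc z)) * cubeGreen F κ hn ((n : ℝ) * K) m2 a Ωc At j
        * mulH (ι := ι) (fun z => hCube ((n : ℝ) * K) j (rpos n Ωc z))‖ ≤ β)
    (hβΩ : ∀ j ∈ labels ((n : ℝ) * K) n Ωc,
      ‖opK (fun z z' => if (cubeSet n ((n : ℝ) * K) Ωc j z ↔ cubeSet n ((n : ℝ) * K) Ωc j z')
            then (if ((blk n z.1 ∈ Ωc') ↔ (blk n z'.1 ∈ Ωc')) then regWt n (fineDom n Ωc) z z' else 0) else 0)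
          m2 a (rBlkWt n Ωc (fineDom n Ωc)) (fieldLink F κ (At j))
          (contourTrans (fieldLink F κ (At j)) (rbaseEmb hn Ωc) (rstairContour hn Ωc))
          (fun z => hCube ((n : ℝ) * K) j (rpos n Ωc z)) * cubeGreenSub F κ hn ((n : ℝ) * K) m2 a Ωc Ωc' At j
        * mulH (ι := ι) (fun z => hCube ((n : ℝ) * K) j (rpos n Ωc z))‖ ≤ β)
    (h3β : (3 : ℝ) ^ (d + 1) * β ≤ Real.exp (-1))
    (Fs : ↥(fineDom n Ωc) → Prop) [DecidablePred Fs] {D D₀ D₁ : ℝ}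
    (hD : ∀ x'', Fs x'' → ∃ μ, D ≤ |rpos n Ωc x μ - rpos n Ωc x'' μ|)
    (hD₀ : ∀ x₁ : ↥(fineDom n Ωc), blk n x₁.1 ∉ Ωc' → ∃ μ, D₀ ≤ |rpos n Ωc x μ - rpos n Ωc x₁ μ|)
    (hD₁ : ∀ x'', Fs x'' → ∀ x₁ : ↥(fineDom n Ωc), blk n x₁.1 ∉ Ωc' →
      ∃ μ, D₁ ≤ |rpos n Ωc x₁ μ - rpos n Ωc x'' μ|) :
    ‖σ • (unitOp x y' (U * fieldLink F κ A x' y') - unitOp x x' U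
          - (unitOp x y (fieldLink F κ A x y) - unitOp x x 1))
        * (greenSub F κ hn m2 a Ωc Ωc' A
          - (b4Op F κ (regWt n (fineDom n Ωc)) m2 a (rBlkWt n Ωc (fineDom n Ωc)) (rbaseEmb hn Ωc)
              (rstairContour hn Ωc) A)⁻¹)
        * mulH (ι := ι) (fun z => if Fs z then (1 : ℝ) else 0)‖
      ≤ 2 ^ (d + 5) * Real.exp (9 / 2) * γH * Real.exp (-((D + D₀ + D₁) / (2 * ((n : ℝ) * K)))) := by
  have hM := M_pos hn hK
  have hK8 : 8 ≤ K := le_trans (by norm_num) hK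
  have h := ineq112_holder hM (rpos n Ωc) (regWt n (fineDom n Ωc)) m2 a (rBlkWt n Ωc (fineDom n Ωc))
    (fieldLink F κ A) (contourTrans (fieldLink F κ A) (rbaseEmb hn Ωc) (rstairContour hn Ωc))
    (regWt_local hn Ωc hK8) (rBlkWt_local hn Ωc hK8)
    (labels ((n : ℝ) * K) n Ωc) (fun j z hz => labels_complete Ωc _ j z hz)
    (cubeSet n ((n : ℝ) * K) Ωc) (cubeSet_of_near hn Ωc) (near_of_cubeSet hn Ωc hK)
    (fun j y z z' hz hz' => cubeSet_iff_of_blk Ωc _ j y z z' hz hz')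
    (fun j => fieldLink F κ (At j))
    (fun j => contourTrans (fieldLink F κ (At j)) (rbaseEmb hn Ωc) (rstairContour hn Ωc))
    (fun j z z' hz hz' => fieldLink_window Ωc F κ _ A At hAt j z z' hz hz')
    (fun j y z hyz hz => contourTrans_window hn Ωc F κ _ A At hAt j y z hyz hz)
    (fun z : ↥(fineDom n Ωc) => blk n z.1 ∈ Ωc')
    (cubeGreen F κ hn ((n : ℝ) * K) m2 a Ωc At) (fun j _ => cubeOp_mul_cubeGreen hn Ωc F κ _ ha hm At j)
    (cubeGreenSub F κ hn ((n : ℝ) * K) m2 a Ωc Ωc' At)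
    (fun j _ => cubeOpSub_mul_cubeGreenSub hn Ωc F κ ha hm At _ Ωc' j)
    (greenSub F κ hn m2 a Ωc Ωc' A) (greenSub_mul_op hn Ωc F κ ha hm A Ωc')
    ((b4Op F κ (regWt n (fineDom n Ωc)) m2 a (rBlkWt n Ωc (fineDom n Ωc)) (rbaseEmb hn Ωc)
      (rstairContour hn Ωc) A)⁻¹)
    (green_mul_op hn Ωc F κ ha hm (regWt n (fineDom n Ωc)) (regWt_nonneg n _) (fun _ _ _ => rfl) A)
    x y x' y' (nbrs_local Ωc hn hK hxy) hxx' (nbrs_local Ωc hn hK hx'y') σ U hγH0 (fun i => hγH i.1 i.2)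
    (fun i => hγHΩ i.1 i.2) hβ0 (fun i => hβ i.1 i.2) (fun i => hβΩ i.1 i.2) h3β Fs
    hD (fun x₁ hx₁ => hD₀ x₁ hx₁) (fun x'' hx'' x₁ hx₁ => hD₁ x'' hx'' x₁ hx₁)
  exact h.trans (le_of_eq (by ring))

end Theorem

end Literature.MathematicalPhysics.QuantumFieldTheory.Balaban1983to89.B4WalkRouteRegion
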